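import Summits.CriticalPhenomena.PercolationContinuityZ3.Theorems.PercNearOneGluingNoHeavyLowerTailGuardedCIL
import HarnessLib

/-!
# `NoHeavyLowerTail` (stmt-CriticalPhenomena-4575) — the GUARDED WORST-FIRST PACKING closes the crux

Lead of the crux (gen 2), 2026-08-19.  Notation of `…GuardedCIL`: `μ = prodBernoulli w` on `Fin n`, relays `A`,
observer `o ∉ A`, level `j`, `π(v) = C(v) ∩ A`, `N = |π(o)|`, guard
`Big(v) = {∃ b ∈ A, v ↮ b ∧ j < |π(b)|}` ("a big block elsewhere"), `R^g_x = {|π(x)| ≤ j} ∩ Big(x)`,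
`Φ(x) = μ(R^g_x)`, `L^g = {1 ≤ N ≤ j} ∩ Big(o)`.

Rank the relays WORST FIRST: a ranking `rk : Fin n → ℕ`, injective on `A`, along which `Φ` is non-increasing
(`rk x < rk y → Φ(y) ≤ Φ(x)`).  On `L^g` the block of `o` is nonempty; its `rk`-first relay is `top(π(o))`, and
`W_x := L^g ∩ {o ↔ x} ∩ {∀ y ∈ A, rk y < rk x → o ↮ y}` is the event "`top(π(o)) = x`".  The GUARDED WORST-FIRST
(top) PACKING inequality is

  `GTP_j :   Σ_{x ∈ A} μ(W_x) / Φ(x) ≤ 1`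

("`Σ_x P(top(π(o)) = x, π(o) small, big block elsewhere | x small, big block elsewhere) ≤ 1`").  Level `j = 1`
is the guarded lonely relay lemma; in the hub calibration (`j+1` extra relays glued to a sink `b`, level `|A|`)
GTP is exactly the worst-first gluing inequality (WF) `Σ_j μ(EXIT, J = a_j)/μ(a_j ↮ b) ≤ 1` of
`…WorstFirstGluing` (proved for two relays in `…WorstFirstGluingTwo`).  It is open in general (0 violations in
exact enumeration and adversarial search at `(|A|,j) = (5,2),(6,2),(6,3),(7,2),(7,3)`; the other selection rules —
uniform, best-first, most-connected — FAIL; lead memo LEAD-GEN2.md).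

This file PROVES  GTP (all levels, all Φ-antitone rankings) ⇒ GCIL (all levels) ⇒ `NoHeavyLowerTail`:

* `GuardedTopPacking.rank*` — the canonical worst-first ranking `rk x = #{y ∈ A : (Φ y, -y) > (Φ x, -x)}` is
  injective on `A` and `Φ`-antitone;
* `GuardedTopPacking.real_Lg_eq_sum` — `μ(L^g) = Σ_{x∈A} μ(W_x)` (partition by the top relay);
* `guardedCIL_of_guardedTopPacking` — GTP ⇒ the hypothesis of `cumulativeIsolation_of_guardedCIL`
  (`μ(L^g) = Σ_x Φ(x)·(μ(W_x)/Φ(x)) ≤ max_x Φ(x)`);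
* `noHeavyLowerTail_of_guardedTopPacking` — GTP ⇒ `NoHeavyLowerTail`.
-/

noncomputable section

namespace Summit.CriticalPhenomena.PercolationContinuityZ3.Theorems

open MeasureTheory Set Literature.Probability.LatticeModels Literature.Probability.Percolation
open scoped Classical BigOperators

variable {n : ℕ}

namespace GuardedTopPacking

/-! ### The canonical worst-first ranking -/

/-- Strict "worse-than" order used to rank relays: larger `Φ` first, ties broken by the smaller index. -/
theorem before_trans {Φ : Fin n → ℝ} {x y z : Fin n}
    (hyx : Φ x < Φ y ∨ (Φ y = Φ x ∧ y < x)) (hzy : Φ y < Φ z ∨ (Φ z = Φ y ∧ z < y)) :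
    Φ x < Φ z ∨ (Φ z = Φ x ∧ z < x) := by
  rcases hyx with h1 | ⟨h1, h1'⟩ <;> rcases hzy with h2 | ⟨h2, h2'⟩
  · exact Or.inl (h1.trans h2)
  · exact Or.inl (h2 ▸ h1)
  · exact Or.inl (h1 ▸ h2)
  · exact Or.inr ⟨h2.trans h1, h2'.trans h1'⟩

/-- The rank of `x`: the number of relays ranked before it. -/
theorem rank_lt_of_before (A : Finset (Fin n)) (Φ : Fin n → ℝ) {x y : Fin n} (hy : y ∈ A)
    (h : Φ x < Φ y ∨ (Φ y = Φ x ∧ y < x)) :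
    (A.filter fun z => Φ y < Φ z ∨ (Φ z = Φ y ∧ z < y)).card <
      (A.filter fun z => Φ x < Φ z ∨ (Φ z = Φ x ∧ z < x)).card := by
  apply Finset.card_lt_card
  rw [Finset.ssubset_iff_subset_ne]
  refine ⟨?_, ?_⟩
  · intro z hz
    rw [Finset.mem_filter] at hz ⊢
    exact ⟨hz.1, before_trans h hz.2⟩
  · intro heq
    have hy' : y ∈ A.filter fun z => Φ x < Φ z ∨ (Φ z = Φ x ∧ z < x) :=
      Finset.mem_filter.2 ⟨hy, h⟩
    rw [← heq, Finset.mem_filter] at hy'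
    rcases hy'.2 with h' | ⟨_, h'⟩
    · exact lt_irrefl _ h'
    · exact lt_irrefl _ h'

/-- The canonical ranking is injective on `A`. -/
theorem rank_injOn (A : Finset (Fin n)) (Φ : Fin n → ℝ) :
    Set.InjOn (fun x => (A.filter fun z => Φ x < Φ z ∨ (Φ z = Φ x ∧ z < x)).card) ↑A := by
  intro x hx y hy hxy
  by_contra hne
  rcases lt_trichotomy (Φ x) (Φ y) with h | h | h
  · exact absurd hxy (ne_of_gt (rank_lt_of_before A Φ hy (Or.inl h)))
  · rcases lt_or_gt_of_ne hne with h' | h'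
    · exact absurd hxy (ne_of_lt (rank_lt_of_before A Φ hx (Or.inr ⟨h, h'⟩)))
    · exact absurd hxy (ne_of_gt (rank_lt_of_before A Φ hy (Or.inr ⟨h.symm, h'⟩)))
  · exact absurd hxy (ne_of_lt (rank_lt_of_before A Φ hx (Or.inl h)))

/-- The canonical ranking is `Φ`-antitone: an earlier rank has `Φ` at least as large. -/
theorem rank_antitone (A : Finset (Fin n)) (Φ : Fin n → ℝ) {x y : Fin n} (_hx : x ∈ A) (hy : y ∈ A)
    (h : (A.filter fun z => Φ x < Φ z ∨ (Φ z = Φ x ∧ z < x)).card <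
      (A.filter fun z => Φ y < Φ z ∨ (Φ z = Φ y ∧ z < y)).card) :
    Φ y ≤ Φ x := by
  by_contra hlt
  push Not at hlt
  exact absurd h (not_lt.2 (le_of_lt (rank_lt_of_before A Φ hy (Or.inl hlt))))

/-! ### Partition of the guarded lower-tail event by the top relay -/

/-- On `L^g` the top relay exists: `L^g ⊆ ⋃_{x ∈ A} W_x`, for any ranking injective on `A`. [folklore] -/
theorem Lg_subset_biUnion (A : Finset (Fin n)) (o : Fin n) (j : ℕ) (rk : Fin n → ℕ) :
    ({ω : BondConfig (Fin n) | 1 ≤ (A.filter fun z => ω ∈ openConn o z).card ∧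
        (A.filter fun z => ω ∈ openConn o z).card ≤ j} ∩
      {ω | ∃ b ∈ A, ω ∉ openConn o b ∧ j < (A.filter fun z => ω ∈ openConn b z).card}) ⊆
    ⋃ x ∈ A, (({ω : BondConfig (Fin n) | 1 ≤ (A.filter fun z => ω ∈ openConn o z).card ∧
        (A.filter fun z => ω ∈ openConn o z).card ≤ j} ∩
      {ω | ∃ b ∈ A, ω ∉ openConn o b ∧ j < (A.filter fun z => ω ∈ openConn b z).card}) ∩
      {ω | ω ∈ openConn o x} ∩ {ω | ∀ y ∈ A, rk y < rk x → ω ∉ openConn o y}) := by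
  intro ω hω
  have h1 : 1 ≤ (A.filter fun z => ω ∈ openConn o z).card := hω.1.1
  have hne : (A.filter fun z => ω ∈ openConn o z).Nonempty := by
    rw [← Finset.card_pos]; omega
  obtain ⟨x, hx, hmin⟩ := Finset.exists_min_image _ rk hne
  rw [Finset.mem_filter] at hx
  refine mem_iUnion₂.2 ⟨x, hx.1, ⟨hω, hx.2⟩, ?_⟩
  intro y hy hlt hoy
  have := hmin y (Finset.mem_filter.2 ⟨hy, hoy⟩)
  omega

/-- The events `W_x` (`x ∈ A`) are pairwise disjoint when the ranking is injective on `A`. [folklore] -/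
theorem pairwiseDisjoint_W (A : Finset (Fin n)) (o : Fin n) (j : ℕ) (rk : Fin n → ℕ)
    (hrk : Set.InjOn rk ↑A) :
    (↑A : Set (Fin n)).PairwiseDisjoint fun x =>
      (({ω : BondConfig (Fin n) | 1 ≤ (A.filter fun z => ω ∈ openConn o z).card ∧
          (A.filter fun z => ω ∈ openConn o z).card ≤ j} ∩
        {ω | ∃ b ∈ A, ω ∉ openConn o b ∧ j < (A.filter fun z => ω ∈ openConn b z).card}) ∩
        {ω | ω ∈ openConn o x} ∩ {ω | ∀ y ∈ A, rk y < rk x → ω ∉ openConn o y}) := by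
  intro x hx y hy hxy
  rw [Function.onFun, Set.disjoint_left]
  rintro ω ⟨⟨_, hox⟩, hx'⟩ ⟨⟨_, hoy⟩, hy'⟩
  have hne : rk x ≠ rk y := fun h => hxy (hrk hx hy h)
  rcases lt_or_gt_of_ne hne with h | h
  · exact hy' x hx h hox
  · exact hx' y hy h hoy

/-- **Partition by the top relay**: `μ(L^g) = Σ_{x ∈ A} μ(W_x)`. [folklore] -/
theorem real_Lg_eq_sum (w : Sym2 (Fin n) → unitInterval) (A : Finset (Fin n)) (o : Fin n) (j : ℕ)
    (rk : Fin n → ℕ) (hrk : Set.InjOn rk ↑A) :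
    (prodBernoulli w).real
        ({ω : BondConfig (Fin n) | 1 ≤ (A.filter fun z => ω ∈ openConn o z).card ∧
            (A.filter fun z => ω ∈ openConn o z).card ≤ j} ∩
          {ω | ∃ b ∈ A, ω ∉ openConn o b ∧ j < (A.filter fun z => ω ∈ openConn b z).card}) =
      ∑ x ∈ A, (prodBernoulli w).real
        (({ω : BondConfig (Fin n) | 1 ≤ (A.filter fun z => ω ∈ openConn o z).card ∧
            (A.filter fun z => ω ∈ openConn o z).card ≤ j} ∩
          {ω | ∃ b ∈ A, ω ∉ openConn o b ∧ j < (A.filter fun z => ω ∈ openConn b z).card}) ∩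
          {ω | ω ∈ openConn o x} ∩ {ω | ∀ y ∈ A, rk y < rk x → ω ∉ openConn o y}) := by
  rw [← measureReal_biUnion_finset (pairwiseDisjoint_W A o j rk hrk)
    (fun _ _ => MeasurableSet.of_discrete)]
  congr 1
  apply Set.Subset.antisymm (Lg_subset_biUnion A o j rk)
  intro ω hω
  obtain ⟨x, -, hx⟩ := mem_iUnion₂.1 hω
  exact hx.1.1

/-- `W_x ⊆ R^g_x`: on `W_x` the block of `x` is the (small) block of `o`, and the big block elsewhere is not
joined to `x`. [folklore] -/
theorem W_subset_Rg (A : Finset (Fin n)) (o x : Fin n) (j : ℕ) (rk : Fin n → ℕ) :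
    (({ω : BondConfig (Fin n) | 1 ≤ (A.filter fun z => ω ∈ openConn o z).card ∧
          (A.filter fun z => ω ∈ openConn o z).card ≤ j} ∩
        {ω | ∃ b ∈ A, ω ∉ openConn o b ∧ j < (A.filter fun z => ω ∈ openConn b z).card}) ∩
        {ω | ω ∈ openConn o x} ∩ {ω | ∀ y ∈ A, rk y < rk x → ω ∉ openConn o y}) ⊆
    ({ω : BondConfig (Fin n) | (A.filter fun z => ω ∈ openConn x z).card ≤ j} ∩
      {ω | ∃ b ∈ A, ω ∉ openConn x b ∧ j < (A.filter fun z => ω ∈ openConn b z).card}) := by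
  rintro ω ⟨⟨⟨⟨_, hle⟩, ⟨b, hb, hob, hbig⟩⟩, hox⟩, -⟩
  have hox' : ω ∈ openConn o x := hox
  refine ⟨?_, ⟨b, hb, ?_, hbig⟩⟩
  · rw [mem_setOf_eq, GuardedCIL.filter_eq_of_reachable A hox']; exact hle
  · intro hxb
    have h1 : (openGraph ω).Reachable o x := hox'
    have h2 : (openGraph ω).Reachable x b := hxb
    exact hob (show (openGraph ω).Reachable o b from h1.trans h2)

end GuardedTopPacking

open GuardedTopPacking in
/-- **GTP ⇒ GCIL.**  If for every finite weighted graph, relay set, observer, level and every ranking `rk`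
of the relays that is injective on `A` and along which `Φ(x) = μ(R^g_x)` is non-increasing, the guarded
worst-first packing inequality `Σ_{x∈A} μ(W_x)/Φ(x) ≤ 1` holds, then the guarded cumulative isolation lemma
holds (hypothesis shape of `Theorems.cumulativeIsolation_of_guardedCIL`). -/
theorem guardedCIL_of_guardedTopPacking
    (hGTP : ∀ (n : ℕ) (w : Sym2 (Fin n) → unitInterval) (A : Finset (Fin n)) (o : Fin n) (j : ℕ)
      (rk : Fin n → ℕ), o ∉ A → Set.InjOn rk ↑A →
      (∀ x ∈ A, ∀ y ∈ A, rk x < rk y →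
        (prodBernoulli w).real
            ({ω : BondConfig (Fin n) | (A.filter fun z => ω ∈ openConn y z).card ≤ j} ∩
              {ω | ∃ b ∈ A, ω ∉ openConn y b ∧ j < (A.filter fun z => ω ∈ openConn b z).card}) ≤
          (prodBernoulli w).real
            ({ω : BondConfig (Fin n) | (A.filter fun z => ω ∈ openConn x z).card ≤ j} ∩
              {ω | ∃ b ∈ A, ω ∉ openConn x b ∧ j < (A.filter fun z => ω ∈ openConn b z).card})) →
      ∑ x ∈ A,
        (prodBernoulli w).real
            (({ω : BondConfig (Fin n) | 1 ≤ (A.filter fun z => ω ∈ openConn o z).card ∧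
                (A.filter fun z => ω ∈ openConn o z).card ≤ j} ∩
              {ω | ∃ b ∈ A, ω ∉ openConn o b ∧ j < (A.filter fun z => ω ∈ openConn b z).card}) ∩
              {ω | ω ∈ openConn o x} ∩ {ω | ∀ y ∈ A, rk y < rk x → ω ∉ openConn o y}) /
          (prodBernoulli w).real
            ({ω : BondConfig (Fin n) | (A.filter fun z => ω ∈ openConn x z).card ≤ j} ∩
              {ω | ∃ b ∈ A, ω ∉ openConn x b ∧ j < (A.filter fun z => ω ∈ openConn b z).card}) ≤ 1)
    (n : ℕ) (w : Sym2 (Fin n) → unitInterval) (A : Finset (Fin n)) (o : Fin n) (j : ℕ)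
    (hA : A.Nonempty) (ho : o ∉ A) :
    ∃ a ∈ A,
      (prodBernoulli w).real
          ({ω : BondConfig (Fin n) | 1 ≤ (A.filter fun z => ω ∈ openConn o z).card ∧
              (A.filter fun z => ω ∈ openConn o z).card ≤ j} ∩
            {ω | ∃ b ∈ A, ω ∉ openConn o b ∧ j < (A.filter fun z => ω ∈ openConn b z).card}) ≤
        (prodBernoulli w).real
          ({ω : BondConfig (Fin n) | (A.filter fun z => ω ∈ openConn a z).card ≤ j} ∩
            {ω | ∃ b ∈ A, ω ∉ openConn a b ∧ j < (A.filter fun z => ω ∈ openConn b z).card}) := by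
  set μ := prodBernoulli w with hμ
  -- Φ and the canonical ranking
  set Φ : Fin n → ℝ := fun x => μ.real
    ({ω : BondConfig (Fin n) | (A.filter fun z => ω ∈ openConn x z).card ≤ j} ∩
      {ω | ∃ b ∈ A, ω ∉ openConn x b ∧ j < (A.filter fun z => ω ∈ openConn b z).card}) with hΦ
  set rk : Fin n → ℕ := fun x => (A.filter fun z => Φ x < Φ z ∨ (Φ z = Φ x ∧ z < x)).card with hrk
  have hinj : Set.InjOn rk ↑A := rank_injOn A Φ
  have hanti : ∀ x ∈ A, ∀ y ∈ A, rk x < rk y → Φ y ≤ Φ x :=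
    fun x hx y hy h => rank_antitone A Φ hx hy h
  -- the maximiser of Φ over A
  obtain ⟨a, ha, hmax⟩ := Finset.exists_max_image A Φ hA
  refine ⟨a, ha, ?_⟩
  set W : Fin n → Set (BondConfig (Fin n)) := fun x =>
    (({ω : BondConfig (Fin n) | 1 ≤ (A.filter fun z => ω ∈ openConn o z).card ∧
        (A.filter fun z => ω ∈ openConn o z).card ≤ j} ∩
      {ω | ∃ b ∈ A, ω ∉ openConn o b ∧ j < (A.filter fun z => ω ∈ openConn b z).card}) ∩
      {ω | ω ∈ openConn o x} ∩ {ω | ∀ y ∈ A, rk y < rk x → ω ∉ openConn o y}) with hW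
  have hpack : ∑ x ∈ A, μ.real (W x) / Φ x ≤ 1 := hGTP n w A o j rk ho hinj hanti
  have hsum := real_Lg_eq_sum w A o j rk hinj
  -- each term: μ(W_x) = Φ x * (μ(W_x)/Φ x) ≤ Φ a * (μ(W_x)/Φ x)
  have hterm : ∀ x ∈ A, μ.real (W x) ≤ Φ a * (μ.real (W x) / Φ x) := by
    intro x hx
    have hWle : μ.real (W x) ≤ Φ x := measureReal_mono (W_subset_Rg A o x j rk) (measure_ne_top _ _)
    have hΦ0 : 0 ≤ Φ x := measureReal_nonneg
    rcases eq_or_lt_of_le hΦ0 with h0 | hpos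
    · have hW0 : μ.real (W x) = 0 := le_antisymm (h0 ▸ hWle) measureReal_nonneg
      rw [hW0]; simp
    · calc μ.real (W x) = Φ x * (μ.real (W x) / Φ x) := by field_simp
        _ ≤ Φ a * (μ.real (W x) / Φ x) :=
          mul_le_mul_of_nonneg_right (hmax x hx) (div_nonneg measureReal_nonneg hΦ0)
  calc μ.real ({ω : BondConfig (Fin n) | 1 ≤ (A.filter fun z => ω ∈ openConn o z).card ∧
            (A.filter fun z => ω ∈ openConn o z).card ≤ j} ∩
          {ω | ∃ b ∈ A, ω ∉ openConn o b ∧ j < (A.filter fun z => ω ∈ openConn b z).card})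
      = ∑ x ∈ A, μ.real (W x) := hsum
    _ ≤ ∑ x ∈ A, Φ a * (μ.real (W x) / Φ x) := Finset.sum_le_sum hterm
    _ = Φ a * ∑ x ∈ A, μ.real (W x) / Φ x := by rw [Finset.mul_sum]
    _ ≤ Φ a * 1 := mul_le_mul_of_nonneg_left hpack measureReal_nonneg
    _ = Φ a := mul_one _

/-- **The guarded worst-first packing (all levels) closes the crux `NoHeavyLowerTail`**, through
`noHeavyLowerTail_of_guardedCIL`. -/
theorem noHeavyLowerTail_of_guardedTopPacking
    (hGTP : ∀ (n : ℕ) (w : Sym2 (Fin n) → unitInterval) (A : Finset (Fin n)) (o : Fin n) (j : ℕ)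
      (rk : Fin n → ℕ), o ∉ A → Set.InjOn rk ↑A →
      (∀ x ∈ A, ∀ y ∈ A, rk x < rk y →
        (prodBernoulli w).real
            ({ω : BondConfig (Fin n) | (A.filter fun z => ω ∈ openConn y z).card ≤ j} ∩
              {ω | ∃ b ∈ A, ω ∉ openConn y b ∧ j < (A.filter fun z => ω ∈ openConn b z).card}) ≤
          (prodBernoulli w).real
            ({ω : BondConfig (Fin n) | (A.filter fun z => ω ∈ openConn x z).card ≤ j} ∩
              {ω | ∃ b ∈ A, ω ∉ openConn x b ∧ j < (A.filter fun z => ω ∈ openConn b z).card})) →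
      ∑ x ∈ A,
        (prodBernoulli w).real
            (({ω : BondConfig (Fin n) | 1 ≤ (A.filter fun z => ω ∈ openConn o z).card ∧
                (A.filter fun z => ω ∈ openConn o z).card ≤ j} ∩
              {ω | ∃ b ∈ A, ω ∉ openConn o b ∧ j < (A.filter fun z => ω ∈ openConn b z).card}) ∩
              {ω | ω ∈ openConn o x} ∩ {ω | ∀ y ∈ A, rk y < rk x → ω ∉ openConn o y}) /
          (prodBernoulli w).real
            ({ω : BondConfig (Fin n) | (A.filter fun z => ω ∈ openConn x z).card ≤ j} ∩
              {ω | ∃ b ∈ A, ω ∉ openConn x b ∧ j < (A.filter fun z => ω ∈ openConn b z).card}) ≤ 1) :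
    Summit.CriticalPhenomena.PercolationContinuityZ3.Theses.PercNearOneGluing.NoHeavyLowerTail :=
  noHeavyLowerTail_of_guardedCIL (fun n w A o j hA ho => guardedCIL_of_guardedTopPacking hGTP n w A o j hA ho)

end Summit.CriticalPhenomena.PercolationContinuityZ3.Theorems

end
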